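import Mathlib
import HarnessLib
import Summits.Ventures.LatticeQCDFlow.Exactness.NCMCGeneralSpaceMartingaleCLT
import Summits.Ventures.LatticeQCDFlow.Exactness.NCMCGeneralSpaceDoeblinPowerPoisson
import Summits.Ventures.LatticeQCDFlow.Exactness.NCMCGeneralSpaceChainMartingale

/-!
# The central limit theorem for time averages of a Markov chain with a Doeblin POWER, from every initial law: `√n ((1/n) Σ_{t<n} f(X_t) − π f) ⇒ N(0, σ²_f)`, `σ²_f = Var_π f + 2 Σ_{k≥1} Cov_π(f(X_0), f(X_k))`

HONEST FRAMING: exact (Metropolis-corrected) sampling algorithms for lattice gauge theory;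
figures of merit are autocorrelation/cost numbers at stated couplings and volumes; no
continuum-physics claim.

Venture `LatticeQCDFlow` (cell pub-lqcd), topic `Exactness`; FANOUT row 13 (`eng-snf`, GEN-19).
NEW WORK of the cell, not a published result; no definition is introduced; nothing is cited as a
fact (the CLT for uniformly ergodic chains via the Poisson equation and the martingale CLT —
Gordin–Lifšic 1978; Meyn–Tweedie 1993 Thm 17.4.4 / 17.0.1 — is NAMED ONLY).  ASSEMBLY of GEN-19's
martingale CLT (`NCMCGeneralSpaceMartingaleCLT.tendstoInDistribution_sum_div_sqrt_of_orthogonal`,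
McLeish), the Poisson equation under a Doeblin power (`NCMCGeneralSpaceDoeblinPowerPoisson`) and the
chain-side verification (`NCMCGeneralSpaceChainMartingale`).  Row 8's `Scoring.markovChain_clt`
proves the same conclusion by regeneration for a ONE-step whole-space minorisation `κ(x,·) ≥ ε ν`;
the present theorem needs only a Doeblin POWER `(nHit κ m)(x, ·) ≥ ε ν` — the certificate GEN-18
established for the NCMC lane of `latflow-snf` (`run_ncmc_chain`, `m = 2`), whose iteration kernel has
no one-step minorisation in general.  The variance is stated in EXACTLY row 8's form, so the two
theorems are interchangeable where both apply.

## Content (`κ` Markov on `S`, `π` invariant, `(nHit κ m)(z, ·) ≥ ε ν` for all `z` with `ε ≠ 0`,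
## `0 < m`, `ν` a probability law; `f` bounded measurable; `μ₀` ANY initial law; `P_{μ₀}` row 8's chain law)

* **`tendstoInDistribution_timeAverage_of_nHit`** — THE THEOREM: for every real random variable `Y`
  with law `N(0, σ²_f)`, `σ²_f = ∫ f̄² dπ + 2 Σ_{k≥0} ∫ f̄ · (kop κ)^[k+1] f̄ dπ` (`f̄ = f − π f`):
  `TendstoInDistribution (fun n x => (√n)⁻¹ Σ_{t<n} (f(x_t) − π f)) atTop Y (fun _ => P_{μ₀}) P'`.
  Proof: `f̄ = h − κh` with `|h| ≤ 4Cm/ε` (Poisson); `Σ_{t<n} f̄(x_t) = M_n + h(x_0) − h(x_n)` with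
  `M_n = Σ_{t<n} (h(x_{t+1}) − κh(x_t))` a sum of bounded increments orthogonal to their past whose
  squares obey the LLN from every start with limit `∫ h² − ∫ (κh)² = σ²_f` (Green–Kubo); McLeish's
  CLT gives `M_n/√n ⇒ N(0, σ²_f)` and the boundary term is `O(1/√n)` surely.
* **`tendstoInDistribution_timeAverage_everyStart_of_nHit`** — the same from every Dirac start `δ_z`.
(The instance binder `[IsProbabilityMeasure P_{μ₀}]` is `inferInstance` at call sites, as in row 8's
`Scoring/MarkovChainCLT.lean`.)

NOT CLAIMED: a rate (Berry–Esseen); unbounded `f`; `σ²_f > 0`; a consistent estimator of `σ²_f`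
(studentisation); chains without a Doeblin power.
-/

namespace Summit.Ventures.LatticeQCDFlow.Exactness.GeneralNCMC

open MeasureTheory ProbabilityTheory Set Filter Finset
open scoped ENNReal Topology

variable {S : Type*} [MeasurableSpace S]

section CLT

variable {κ : Kernel S S} [IsMarkovKernel κ] {π : Measure S} [IsProbabilityMeasure π]
  {ν : Measure S} [IsProbabilityMeasure ν] {ε : ℝ≥0∞} {m : ℕ}

/-- **THE MARKOV-CHAIN CLT UNDER A DOEBLIN POWER, FROM ANY INITIAL LAW.**  `κ` Markov with invariant
probability `π` and `(nHit κ m)(z, ·) ≥ ε ν` for all `z` (`ε ≠ 0`, `0 < m`), `|f| ≤ C` measurable,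
`σ²_f = ∫ f̄² dπ + 2 Σ_{k≥0} ∫ f̄ · κ^{k+1} f̄ dπ`; `μ₀` ANY initial law.  For every real random variable
`Y` with law `N(0, σ²_f)`:
`TendstoInDistribution (fun n x => (√n)⁻¹ Σ_{t<n} (f(x_t) − π f)) atTop Y (fun _ => P_{μ₀}) P'`. -/
theorem tendstoInDistribution_timeAverage_of_nHit (hπ : Kernel.Invariant κ π) (hε : ε ≠ 0)
    (hmin : ∀ z, ε • ν ≤ nHit κ m z) (hm : 0 < m)
    {f : S → ℝ} (hf : Measurable f) {C : ℝ} (hC : ∀ x, |f x| ≤ C)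
    (μ₀ : Measure S) [IsProbabilityMeasure μ₀]
    {Ω' : Type*} [MeasurableSpace Ω'] {P' : Measure Ω'} [IsProbabilityMeasure P'] {Y : Ω' → ℝ}
    (hY : HasLaw Y (gaussianReal 0 (Real.toNNReal ((∫ y, (f y - ∫ z, f z ∂π) ^ 2 ∂π)
      + 2 * ∑' k, ∫ y, (f y - ∫ z, f z ∂π)
        * (Scoring.kop κ)^[k + 1] (fun y => f y - ∫ z, f z ∂π) y ∂π))) P')
    [IsProbabilityMeasure (Kernel.trajMeasure (X := fun _ : ℕ => S) μ₀
        (fun n : ℕ => κ.comap (fun hh : (i : ↥(Finset.Iic n)) → S => hh ⟨n, Finset.mem_Iic.2 le_rfl⟩)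
          (measurable_pi_apply _)))] :
    TendstoInDistribution (fun (n : ℕ) (x : ℕ → S) =>
        (Real.sqrt n)⁻¹ * ∑ t ∈ Finset.range n, (f (x t) - ∫ z, f z ∂π))
      atTop Y (fun _ => Kernel.trajMeasure (X := fun _ : ℕ => S) μ₀
        (fun n : ℕ => κ.comap (fun hh : (i : ↥(Finset.Iic n)) → S => hh ⟨n, Finset.mem_Iic.2 le_rfl⟩)
          (measurable_pi_apply _))) P' := by
  set P := Kernel.trajMeasure (X := fun _ : ℕ => S) μ₀
    (fun n : ℕ => κ.comap (fun hh : (i : ↥(Finset.Iic n)) → S => hh ⟨n, Finset.mem_Iic.2 le_rfl⟩)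
      (measurable_pi_apply _)) with hP
  -- the centred observable
  set fb : S → ℝ := fun y => f y - ∫ z, f z ∂π with hfb
  have hC0 : 0 ≤ C := (abs_nonneg _).trans (hC (Classical.choice (nonempty_of_isProbabilityMeasure π)))
  have hfbm : Measurable fb := hf.sub measurable_const
  have hmean : |∫ z, f z ∂π| ≤ C := by
    rw [← Real.norm_eq_abs]
    calc ‖∫ z, f z ∂π‖ ≤ C * π.real univ :=
          norm_integral_le_of_norm_le_const (Eventually.of_forall fun z => by
            rw [Real.norm_eq_abs]; exact hC z)
      _ = C := by rw [probReal_univ, mul_one]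
  have hfbC : ∀ y, |fb y| ≤ 2 * C := fun y => by
    calc |fb y| = |f y - ∫ z, f z ∂π| := rfl
      _ ≤ |f y| + |∫ z, f z ∂π| := abs_sub _ _
      _ ≤ C + C := add_le_add (hC y) hmean
      _ = 2 * C := by ring
  have hfb0 : ∫ y, fb y ∂π = 0 := by
    show ∫ y, (f y - ∫ z, f z ∂π) ∂π = 0
    rw [integral_sub (Scoring.integrable_of_bounded π hf hC) (integrable_const _), integral_const,
      probReal_univ, one_smul, sub_self]
  -- the Poisson solution
  haveI := isMarkovKernel_nHit κ m
  haveI : Nonempty S := ⟨Classical.choice (nonempty_of_isProbabilityMeasure π)⟩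
  have hε1 : ε ≤ 1 := eps_le_one_of_minorised hmin
  have hε0 : 0 < ε := pos_iff_ne_zero.2 hε
  have hminS : ∀ x {B : Set S}, MeasurableSet B → ε * ν B ≤ nHit κ m x B :=
    fun x _ hB => minorised_setwise hmin x hB
  obtain ⟨h, hhm, hhb, hpois⟩ := poisson_exists_of_nHit hminS hε0 hε1 hm hπ hfbm hfbC hfb0
  set Ch : ℝ := 2 * (2 * C) * m / ε.toReal with hCh
  have hKm := Scoring.measurable_kop κ hhm
  have hKb : ∀ x, |Scoring.kop κ h x| ≤ Ch := Scoring.abs_kop_le κ hhb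
  -- the martingale increments
  set D : ℕ → (ℕ → S) → ℝ := fun t x => h (x (t + 1)) - Scoring.kop κ h (x t) with hD
  have hDm : ∀ t, Measurable (D t) := fun t =>
    (hhm.comp (measurable_pi_apply (t + 1))).sub (hKm.comp (measurable_pi_apply t))
  have hDb : ∀ t x, |D t x| ≤ 2 * Ch := fun t x => by
    calc |D t x| = |h (x (t + 1)) - Scoring.kop κ h (x t)| := rfl
      _ ≤ |h (x (t + 1))| + |Scoring.kop κ h (x t)| := abs_sub _ _
      _ ≤ Ch + Ch := add_le_add (hhb _) (hKb _)
      _ = 2 * Ch := by ring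
  have horth : ∀ (n : ℕ) (F : (Fin n → ℝ) → ℝ) (K : ℝ), Measurable F → (∀ v, |F v| ≤ K) →
      ∫ x, F (fun i => D i x) * D n x ∂P = 0 := fun n F K hF hK => by
    rw [hP]
    exact chain_increment_orthogonal κ μ₀ hhm hhb n F K hF hK
  -- the quadratic variation, from every start
  set σ2 : ℝ := ∫ x, h x ^ 2 ∂π - ∫ x, (Scoring.kop κ h x) ^ 2 ∂π with hσ2
  have hQV : ∀ᵐ x ∂P, Tendsto (fun n : ℕ => (∑ t ∈ range n, D t x ^ 2) / n) atTop (𝓝 σ2) := by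
    rw [hP]
    exact chain_incrementSq_anyLaw_of_nHit hπ hε hmin hhm hhb μ₀
  have hσ2nn : 0 ≤ σ2 := by
    rw [hσ2, ← chain_integral_increment_sq κ hπ hhm hhb]
    exact integral_nonneg fun x => sq_nonneg _
  -- the variance is the Green–Kubo variance
  have hvar : σ2 = (∫ y, fb y ^ 2 ∂π) + 2 * ∑' k, ∫ y, fb y * (Scoring.kop κ)^[k + 1] fb y ∂π := by
    have h1 := integral_sq_sub_sq_kop_eq_greenKubo_of_nHit hminS hε0 hε1 hm hπ hfbm hfbC hfb0
      hhm hhb hpois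
    rw [hσ2, h1]
    rfl
  have hY' : HasLaw Y (gaussianReal 0 σ2.toNNReal) P' := by
    rw [hvar]
    exact hY
  -- McLeish
  have hclt := tendstoInDistribution_sum_div_sqrt_of_orthogonal (P := P) hDm hDb horth hσ2nn hQV hY'
  -- the boundary term
  have hYm : ∀ n : ℕ, Measurable fun x : ℕ → S =>
      (Real.sqrt n)⁻¹ * ∑ t ∈ Finset.range n, (f (x t) - ∫ z, f z ∂π) := fun n =>
    measurable_const.mul (Finset.measurable_sum _ fun t _ => hfbm.comp (measurable_pi_apply t))
  refine tendstoInDistribution_of_tendstoInMeasure_sub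
    (X := fun (n : ℕ) (x : ℕ → S) => (Real.sqrt n)⁻¹ * ∑ t ∈ range n, D t x) _ Y hclt ?_
    (fun n => (hYm n).aemeasurable)
  have hdiff : ∀ (n : ℕ) (x : ℕ → S),
      ((fun (n : ℕ) (x : ℕ → S) => (Real.sqrt n)⁻¹ * ∑ t ∈ Finset.range n, (f (x t) - ∫ z, f z ∂π))
        - fun (n : ℕ) (x : ℕ → S) => (Real.sqrt n)⁻¹ * ∑ t ∈ range n, D t x) n x
        = (Real.sqrt n)⁻¹ * (h (x 0) - h (x n)) := by
    intro n x
    simp only [Pi.sub_apply]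
    rw [← mul_sub]
    congr 1
    have htel := sum_centred_eq_sum_increment_add (Scoring.kop κ) hpois x n
    change ∑ t ∈ range n, fb (x t) - ∑ t ∈ range n, D t x = h (x 0) - h (x n)
    rw [htel]
    ring
  have hDm' : ∀ n : ℕ, Measurable fun x : ℕ → S => (Real.sqrt n)⁻¹ * ∑ t ∈ range n, D t x := fun n =>
    measurable_const.mul (Finset.measurable_sum _ fun t _ => hDm t)
  refine tendstoInMeasure_of_tendsto_ae (fun n => ((hYm n).sub (hDm' n)).aestronglyMeasurable)
    (ae_of_all _ fun x => ?_)
  simp_rw [hdiff]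
  have h0 : Tendsto (fun n : ℕ => (Real.sqrt n)⁻¹ * (2 * Ch)) atTop (𝓝 0) := by
    have := (tendsto_inv_atTop_zero.comp
      (Real.tendsto_sqrt_atTop.comp tendsto_natCast_atTop_atTop)).mul_const (2 * Ch)
    simpa using this
  refine squeeze_zero_norm (fun n => ?_) h0
  rw [Real.norm_eq_abs, abs_mul, abs_inv, abs_of_nonneg (Real.sqrt_nonneg _)]
  refine mul_le_mul_of_nonneg_left ?_ (inv_nonneg.2 (Real.sqrt_nonneg _))
  calc |h (x 0) - h (x n)| ≤ |h (x 0)| + |h (x n)| := abs_sub _ _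
    _ ≤ Ch + Ch := add_le_add (hhb _) (hhb _)
    _ = 2 * Ch := by ring

/-- **… from every Dirac start**: for every initial STATE `z`, under `P_{δ_z}` the same convergence in
distribution holds (the case `μ₀ = δ_z`). -/
theorem tendstoInDistribution_timeAverage_everyStart_of_nHit (hπ : Kernel.Invariant κ π)
    (hε : ε ≠ 0) (hmin : ∀ z, ε • ν ≤ nHit κ m z) (hm : 0 < m)
    {f : S → ℝ} (hf : Measurable f) {C : ℝ} (hC : ∀ x, |f x| ≤ C) (z : S)
    {Ω' : Type*} [MeasurableSpace Ω'] {P' : Measure Ω'} [IsProbabilityMeasure P'] {Y : Ω' → ℝ}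
    (hY : HasLaw Y (gaussianReal 0 (Real.toNNReal ((∫ y, (f y - ∫ z, f z ∂π) ^ 2 ∂π)
      + 2 * ∑' k, ∫ y, (f y - ∫ z, f z ∂π)
        * (Scoring.kop κ)^[k + 1] (fun y => f y - ∫ z, f z ∂π) y ∂π))) P')
    [IsProbabilityMeasure (Kernel.trajMeasure (X := fun _ : ℕ => S) (Measure.dirac z)
        (fun n : ℕ => κ.comap (fun hh : (i : ↥(Finset.Iic n)) → S => hh ⟨n, Finset.mem_Iic.2 le_rfl⟩)
          (measurable_pi_apply _)))] :
    TendstoInDistribution (fun (n : ℕ) (x : ℕ → S) =>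
        (Real.sqrt n)⁻¹ * ∑ t ∈ Finset.range n, (f (x t) - ∫ z, f z ∂π))
      atTop Y (fun _ => Kernel.trajMeasure (X := fun _ : ℕ => S) (Measure.dirac z)
        (fun n : ℕ => κ.comap (fun hh : (i : ↥(Finset.Iic n)) → S => hh ⟨n, Finset.mem_Iic.2 le_rfl⟩)
          (measurable_pi_apply _))) P' :=
  tendstoInDistribution_timeAverage_of_nHit hπ hε hmin hm hf hC (Measure.dirac z) hY

end CLT

end Summit.Ventures.LatticeQCDFlow.Exactness.GeneralNCMC
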